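import Literature.AnabelianGeometry.AbsoluteAnabelian.AbsTopIProp410SameFieldProofs
import Mathlib.GroupTheory.Schreier
import HarnessLib

/-!
# [AbsTopI] Prop 4.10 (iii), residue (R2) — preliminaries: t.f.g. open subgroups of finite index,
# finite-index subgroups above `H′^{co-fr}` are traces of open subgroups of `Π^tp_Y`, and the
# finite-level surjectivity (R1) for `H′ ∩ N` (proof-only)

S. Mochizuki, *Topics in Absolute Anabelian Geometry I: Generalities* [AbsTopI] (J. Math. Sci.
Univ. Tokyo 19 (2012)), §0 p. 8, Prop 4.10 (i)/(iii) p. 60 (proof p. 61 l. 31 with p. 60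
l. 8–13: "`H ↠ H/H^{co-fr}` corresponds to the tempered covering [...] determined by the universal
covering of the dual graph of the special fiber"); manuscript pagination, lit key
`paper:url-11ac98ba15fc`, read on the page.  S. Mochizuki, *Semi-graphs of anabelioids* [SemiAnbd]
Def 3.1 (i) p. 33, §6 p. 69.

Context: node AbsTopI:Prop4.10(iii) of the cell's sub-DAG `HOME/plan/L4/SUBDAG-AbsTopI-Prop410.md`;
its closers (`prop410iiiAt_of_residues''''`, `AbsTopIProp410SameFieldProofs.lean`) carry the
graph-level residue (R2) "`H′ ≤ f(f⁻¹H′) · H′^{co-fr}` for every Y-index `H′`" (surjectivity of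
`π₁(Γ_{X_{f⁻¹H′}}) → π₁(Γ_{Y_{H′}})`, the surjective half of "filling in a cusp does not change the
dual graph").  The companion file `AbsTopIProp410GraphSurjectivityProofs.lean` derives (R2) from
TOPOLOGICAL FINITE GENERATION of `Δ^tp_X` by M. Hall's theorem; this file supplies its three
group-theoretic inputs:

* `IsTopologicallyFinitelyGenerated.subgroup_isOpen_of_finiteIndex` — an OPEN subgroup of FINITE
  INDEX of a topologically finitely generated group is topologically finitely generated (Schreier's
  lemma on a dense finitely generated subgroup; the compact case is the tree's
  `IsTopologicallyFinitelyGenerated.subgroup_isOpen`), and `…of_denseRange`, whence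
  `isTopologicallyFinitelyGenerated_deltaHat_of_deltaTemp` (residue (c) "tfg `Δ̂_X`" from tfg
  `Δ^tp_X`);
* `exists_openNormal_inf_deltaTemp_le` (an open normal `N₁ ⊴ Π^tp_Y` with
  `N₁ ∩ Δ^tp_Y = H′^{co-fr}`, by temperedness — as in
  `AbsTopIProp410ProfiniteClosednessProofs.lean`) and `exists_openNormal_finiteIndex_inf_le`:
  every FINITE-INDEX `P′` with `H′^{co-fr} ≤ P′ ≤ H′` is CUT OUT by an open normal subgroup `N`
  of finite index of `Π^tp_Y` (`N ∩ H′ ⊆ P′`);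
* `DeCuspidalization.le_map_sup_of_deltaHat'` — (R1) "`Δ^tp_Y = f(Δ^tp_X) · L`" for EVERY open
  normal finite-index `L ≤ Δ^tp_Y` (gen 5's `le_sup_of_deltaHat`, stated there for Y-indices only),
  and `DeCuspidalization.le_mapComap_sup_inf`: `H′ ≤ f(f⁻¹H′) · (H′ ∩ N)` for every open normal
  finite-index `N ⊴ Π^tp_Y` — `f(f⁻¹H′)` is PROFINITELY DENSE in `H′`.

Inputs are hypotheses stated in the signatures (no new named facts; FACT-LIST untouched).  HONEST
FRAMING: refereed prerequisite papers; nothing here bears on [IUTchIII] Cor 3.12; typed ≠ proved.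
-/

noncomputable section

open _root_.Topology Filter

namespace Literature.AnabelianGeometry.AbsoluteAnabelian

/-! ### Topological finite generation of open subgroups of finite index -/

section TFG

variable {G : Type*} [Group G] [TopologicalSpace G] [IsTopologicalGroup G]
variable {H : Type*} [Group H] [TopologicalSpace H] [IsTopologicalGroup H]

/-- Topological finite generation passes along a continuous homomorphism with DENSE range (the
image of a dense finitely generated subgroup is finitely generated and dense).
[cite: MochizukiAbsTopI2012, §0 p.8] -/
theorem IsTopologicallyFinitelyGenerated.of_denseRange (f : G →ₜ* H) (hf : DenseRange f)
    (h : IsTopologicallyFinitelyGenerated G) : IsTopologicallyFinitelyGenerated H := by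
  classical
  obtain ⟨s, hs⟩ := h.exists_finset
  refine ⟨⟨s.image f, ?_⟩⟩
  rw [Finset.coe_image]
  change (Subgroup.closure (f.toMonoidHom '' (s : Set G))).topologicalClosure = ⊤
  rw [← MonoidHom.map_closure]
  exact DenseRange.topologicalClosure_map_subgroup (f := f.toMonoidHom) (map_continuous f) hf hs

omit [TopologicalSpace H] [IsTopologicalGroup H] in
/-- **An open subgroup of finite index of a topologically finitely generated group is topologically
finitely generated**: a dense finitely generated subgroup `Λ` meets `U` in a subgroup of finite
index in `Λ` — finitely generated by Schreier's lemma — which is dense in the open `U`.  (The tree's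
`IsTopologicallyFinitelyGenerated.subgroup_isOpen` is the compact case, where openness gives the
finite index; same proof.) [cite: MochizukiAbsTopI2012, §0 p.8] -/
theorem IsTopologicallyFinitelyGenerated.subgroup_isOpen_of_finiteIndex
    (h : IsTopologicallyFinitelyGenerated G) (U : Subgroup G) (hU : IsOpen (U : Set G))
    [U.FiniteIndex] : IsTopologicallyFinitelyGenerated U := by
  classical
  obtain ⟨s, hs⟩ := h.exists_finset
  set Λ : Subgroup G := Subgroup.closure (s : Set G) with hΛ
  haveI : Group.FG Λ := Group.closure_finset_fg s
  haveI : Group.FG ↥(U.subgroupOf Λ) := Subgroup.fg_of_index_ne_zero _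
  obtain ⟨t, ht⟩ := Group.fg_def.mp (inferInstance : Group.FG ↥(U.subgroupOf Λ))
  let ι : ↥(U.subgroupOf Λ) →* G := Λ.subtype.comp (U.subgroupOf Λ).subtype
  have hιU : ∀ x : ↥(U.subgroupOf Λ), ι x ∈ U := fun x => x.2
  let j : ↥(U.subgroupOf Λ) →* U :=
    { toFun := fun x => ⟨ι x, hιU x⟩
      map_one' := by ext; simp [ι]
      map_mul' := fun x y => by ext; simp [ι] }
  have hj : U.subtype.comp j = ι := by ext; rfl
  refine ⟨⟨t.image j, ?_⟩⟩
  have hmap : (Subgroup.closure ((t.image j : Finset U) : Set U)).map U.subtype = Λ ⊓ U := by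
    rw [Finset.coe_image, ← MonoidHom.map_closure, Subgroup.map_map, hj, ht,
      ← MonoidHom.range_eq_map]
    change (Λ.subtype.comp (U.subgroupOf Λ).subtype).range = Λ ⊓ U
    rw [MonoidHom.range_comp, Subgroup.range_subtype, Subgroup.subgroupOf_map_subtype, inf_comm]
  have hdense : Dense (Λ : Set G) := by
    rw [dense_iff_closure_eq, ← Subgroup.topologicalClosure_coe, hs, Subgroup.coe_top]
  rw [eq_top_iff]
  rintro u -
  change u ∈ closure ((Subgroup.closure ((t.image j : Finset U) : Set U) : Subgroup U) : Set U)
  rw [closure_subtype, ← Subgroup.coe_subtype, ← Subgroup.coe_map, hmap, Subgroup.coe_inf,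
    Set.inter_comm]
  exact hdense.open_subset_closure_inter hU u.2

end TFG

namespace AbsTopI.Prop410

open Literature.AnabelianGeometry.SemiGraphs
open Literature.AnabelianGeometry.AbsoluteAnabelian.AbsTopI

variable {p : ℕ} [Fact p.Prime]

/-- **Residue (c) from tfg of `Δ^tp_X`**: if `Δ^tp_X` is topologically finitely generated, so is
its profinite completion `Δ_X` (`Δ^tp_X → Δ_X` has dense range).
[cite: MochizukiSemiAnbd2006, §6 p.69] -/
theorem isTopologicallyFinitelyGenerated_deltaHat_of_deltaTemp (X : TemperedCurve p)
    (h : IsTopologicallyFinitelyGenerated X.DeltaTemp) :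
    IsTopologicallyFinitelyGenerated X.DeltaHat :=
  h.of_denseRange X.deltaToHat X.denseRange_deltaToHat

/-! ### Finite-index subgroups above `H′^{co-fr}` are traces of open subgroups of `Π^tp_Y` -/

/-- **An open normal `N₁ ⊴ Π^tp_Y` with `N₁ ∩ Δ^tp_Y = H′^{co-fr}`** (`Π^tp_Y` tempered, `H′` a
Y-index admitting a minimal co-free subgroup): `H′^{co-fr}` is normal in `Π^tp_Y` and open in
`Δ^tp_Y`, so the tempered basis gives an open normal `N₀` with `N₀ ∩ Δ ⊆ H′^{co-fr}`, and
`N₁ := N₀ · H′^{co-fr}` works. [cite: MochizukiAbsTopI2012, §0 p.8] -/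
theorem exists_openNormal_inf_deltaTemp_le {Y : TemperedCurve p} (dY : Y.GroupLevelData)
    (H' : CharOpenSubgroup Y.DeltaTemp) {M : Subgroup Y.PiTemp}
    (hM : IsMinimalCofreeIn H'.toSubgroup M) :
    ∃ N₁ : OpenNormalSubgroup Y.PiTemp, cofreeCore H'.toSubgroup ≤ N₁.toSubgroup ∧
      ∀ x ∈ N₁.toSubgroup, x ∈ Y.DeltaTemp → x ∈ cofreeCore H'.toSubgroup := by
  classical
  haveI : Y.DeltaTemp.Normal := by
    unfold TemperedCurve.DeltaTemp
    infer_instance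
  haveI hCn : (cofreeCore H'.toSubgroup).Normal := cofreeCore_normal_of_charOpen H'
  have hCΔ : cofreeCore H'.toSubgroup ≤ Y.DeltaTemp := (cofreeCore_le _).trans H'.le
  have hopen : IsOpen (((cofreeCore H'.toSubgroup).subgroupOf Y.DeltaTemp :
      Subgroup Y.DeltaTemp) : Set Y.DeltaTemp) := isOpen_cofreeCore_subgroupOf H' hM
  obtain ⟨U, hUo, hUC⟩ := isOpen_induced_iff.mp hopen
  have h1U : (1 : Y.PiTemp) ∈ U := by
    have h1 : (1 : Y.DeltaTemp) ∈ Subtype.val ⁻¹' U := by rw [hUC]; exact Subgroup.one_mem _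
    exact h1
  obtain ⟨N₀, -, hN₀U⟩ := dY.isTempered.basis U (hUo.mem_nhds h1U)
  have hN₀ : ∀ x ∈ N₀.toSubgroup, x ∈ Y.DeltaTemp → x ∈ cofreeCore H'.toSubgroup := by
    intro x hx hxΔ
    have hx' : (⟨x, hxΔ⟩ : Y.DeltaTemp) ∈ Subtype.val ⁻¹' U := hN₀U hx
    rw [hUC] at hx'
    exact Subgroup.mem_subgroupOf.mp hx'
  have hN₁open : IsOpen ((N₀.toSubgroup ⊔ cofreeCore H'.toSubgroup : Subgroup Y.PiTemp) :
      Set Y.PiTemp) := Subgroup.isOpen_mono le_sup_left N₀.isOpen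
  refine ⟨⟨⟨N₀.toSubgroup ⊔ cofreeCore H'.toSubgroup, hN₁open⟩, inferInstance⟩, le_sup_right, ?_⟩
  intro x hx hxΔ
  have hx' : x ∈ ((N₀.toSubgroup ⊔ cofreeCore H'.toSubgroup : Subgroup Y.PiTemp) :
      Set Y.PiTemp) := hx
  rw [Subgroup.mul_normal] at hx'
  obtain ⟨n, hn, c, hc, rfl⟩ := Set.mem_mul.mp hx'
  have hnΔ : n ∈ Y.DeltaTemp := by
    have h := Y.DeltaTemp.mul_mem hxΔ (Y.DeltaTemp.inv_mem (hCΔ hc))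
    rwa [mul_inv_cancel_right] at h
  exact Subgroup.mul_mem _ (hN₀ n hn hnΔ) hc

/-- **Every finite-index subgroup `P′` with `H′^{co-fr} ≤ P′ ≤ H′` is cut out by an open normal
subgroup of finite index of `Π^tp_Y`**: there is an open normal `N ⊴ Π^tp_Y` of finite index with
`N ∩ H′ ⊆ P′` — in the discrete quotient `Π^tp_Y / N₁` (previous lemma) the image of `P′` has
finite index (`[Π : Δ·N₁] < ∞` by the open mapping theorem, `[Δ : H′] < ∞`, `[H′ : P′] < ∞`), and
the preimage of its normal core works because `N₁ ∩ H′ = H′^{co-fr} ≤ P′`.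
[cite: MochizukiAbsTopI2012, §0 p.8] -/
theorem exists_openNormal_finiteIndex_inf_le {Y : TemperedCurve p} (dY : Y.GroupLevelData)
    (H' : CharOpenSubgroup Y.DeltaTemp) {M : Subgroup Y.PiTemp}
    (hM : IsMinimalCofreeIn H'.toSubgroup M) {P' : Subgroup Y.PiTemp}
    (hP'H : P' ≤ H'.toSubgroup) (hCP : cofreeCore H'.toSubgroup ≤ P')
    (hfi : (P'.subgroupOf H'.toSubgroup).FiniteIndex) :
    ∃ N : OpenNormalSubgroup Y.PiTemp, N.toSubgroup.FiniteIndex ∧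
      ∀ x ∈ N.toSubgroup, x ∈ H'.toSubgroup → x ∈ P' := by
  classical
  haveI := dY.secondCountableTopology
  obtain ⟨N₁, hCN₁, hN₁Δ⟩ := exists_openNormal_inf_deltaTemp_le dY H' hM
  let π : Y.PiTemp →* Y.PiTemp ⧸ N₁.toSubgroup := QuotientGroup.mk' N₁.toSubgroup
  have hπs : Function.Surjective π := QuotientGroup.mk'_surjective _
  have hker : π.ker = N₁.toSubgroup := QuotientGroup.ker_mk' _
  -- the image of `H′` has finite index in `Π / N₁`
  have hH : (H'.toSubgroup.map π).index ≠ 0 := by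
    have hle : H'.toSubgroup.map π ≤ Y.DeltaTemp.map π := Subgroup.map_mono H'.le
    rw [← Subgroup.relIndex_mul_index hle]
    refine mul_ne_zero ?_ ?_
    · have h1 : (H'.toSubgroup.map π).relIndex (Y.DeltaTemp.map π) =
          (H'.toSubgroup ⊔ N₁.toSubgroup).relIndex Y.DeltaTemp := by
        rw [← Subgroup.relIndex_comap, Subgroup.comap_map_eq, hker]
      rw [h1]
      haveI := H'.finiteIndex
      exact ne_zero_of_dvd_ne_zero Subgroup.FiniteIndex.index_ne_zero
        (Subgroup.relIndex_dvd_of_le_left Y.DeltaTemp le_sup_left)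
    · rw [← Subgroup.index_comap_of_surjective _ hπs, Subgroup.comap_map_eq, hker]
      exact index_deltaTemp_sup_ne_zero Y dY.isTempered N₁.toSubgroup N₁.isOpen
  -- hence so has the image of `P′`
  have hP : (P'.map π).index ≠ 0 := by
    have hle : P'.map π ≤ H'.toSubgroup.map π := Subgroup.map_mono hP'H
    rw [← Subgroup.relIndex_mul_index hle]
    refine mul_ne_zero ?_ hH
    have h1 : (P'.map π).relIndex (H'.toSubgroup.map π) =
        (P' ⊔ N₁.toSubgroup).relIndex H'.toSubgroup := by
      rw [← Subgroup.relIndex_comap, Subgroup.comap_map_eq, hker]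
    rw [h1]
    exact ne_zero_of_dvd_ne_zero hfi.index_ne_zero
      (Subgroup.relIndex_dvd_of_le_left H'.toSubgroup le_sup_left)
  haveI : (P'.map π).FiniteIndex := ⟨hP⟩
  -- the preimage of the normal core of the image of `P′`
  let K : Subgroup (Y.PiTemp ⧸ N₁.toSubgroup) := (P'.map π).normalCore
  have hN₁K : N₁.toSubgroup ≤ K.comap π := fun x hx => by
    have hx1 : π x = 1 := (QuotientGroup.eq_one_iff x).mpr hx
    rw [Subgroup.mem_comap, hx1]
    exact Subgroup.one_mem _
  have hKopen : IsOpen ((K.comap π : Subgroup Y.PiTemp) : Set Y.PiTemp) :=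
    Subgroup.isOpen_mono hN₁K N₁.isOpen
  have hKfin : (K.comap π).FiniteIndex := by
    refine ⟨?_⟩
    rw [Subgroup.index_comap_of_surjective _ hπs]
    exact Subgroup.FiniteIndex.index_ne_zero
  refine ⟨⟨⟨K.comap π, hKopen⟩, inferInstance⟩, hKfin, ?_⟩
  intro x hx hxH
  have hxK : π x ∈ P'.map π := Subgroup.normalCore_le _ (Subgroup.mem_comap.mp hx)
  obtain ⟨q, hq, hqx⟩ := hxK
  -- `q⁻¹ x ∈ N₁ ∩ H′ = H′^{co-fr} ≤ P′`
  have hqx' : q⁻¹ * x ∈ N₁.toSubgroup := by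
    rw [← hker, MonoidHom.mem_ker, map_mul, map_inv, hqx, inv_mul_cancel]
  have hmem : q⁻¹ * x ∈ cofreeCore H'.toSubgroup :=
    hN₁Δ _ hqx' (H'.le (H'.toSubgroup.mul_mem (H'.toSubgroup.inv_mem (hP'H hq)) hxH))
  have hx' : x = q * (q⁻¹ * x) := by rw [mul_inv_cancel_left]
  rw [hx']
  exact P'.mul_mem hq (hCP hmem)

/-! ### (R1) for open normal finite-index subgroups of `Δ^tp_Y`; profinite density of `f(f⁻¹H′)` -/

namespace DeCuspidalization

variable {X Y : TemperedCurve p} (E : DeCuspidalization X Y)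

/-- **(R1) for an arbitrary open normal finite-index `L ≤ Δ^tp_Y`**: if `Δ_Y ⊆ f̂(Δ_X)` and
`Δ^tp_Y → Δ_Y` is a profinite completion, then `Δ^tp_Y = f(Δ^tp_X) · L` — the proof of
`le_sup_of_deltaHat` (`AbsTopIProp410FiniteLevelProofs.lean`, stated there for Y-indices): `L` is
cut out by an open normal `V ⊴ Δ_Y`; a preimage `x̂ ∈ Δ_X` of `toHat_Y(y)` is approximated inside
the open `f̂⁻¹(toHat_Y(y) · V)` by some `toHat_X(d)`, `d ∈ Δ^tp_X`, and then `y⁻¹ f(d) ∈ L`.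
[cite: MochizukiAbsTopI2012, Prop 4.10 (iii) p.60] -/
theorem le_map_sup_of_deltaHat' (hΔY : IsProfiniteCompletion Y.deltaToHat)
    (hhat : Y.DeltaHat ≤ X.DeltaHat.map E.fHat.toMonoidHom) (L : Subgroup Y.PiTemp)
    (hLo : IsOpen ((L.subgroupOf Y.DeltaTemp : Subgroup Y.DeltaTemp) : Set Y.DeltaTemp))
    (hLn : (L.subgroupOf Y.DeltaTemp).Normal) (hLf : (L.subgroupOf Y.DeltaTemp).FiniteIndex) :
    Y.DeltaTemp ≤ X.DeltaTemp.map E.f.toMonoidHom ⊔ L := by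
  intro y hy
  let U : OpenNormalSubgroup Y.DeltaTemp := ⟨⟨L.subgroupOf Y.DeltaTemp, hLo⟩, hLn⟩
  obtain ⟨V, hV⟩ := hΔY.comap_surjective U hLf
  let φ : X.DeltaHat → Y.DeltaHat := fun z => ⟨E.fHat z, E.map_deltaHat_le ⟨z, z.2, rfl⟩⟩
  have hφ : Continuous φ := (E.fHat.continuous.comp continuous_subtype_val).subtype_mk _
  obtain ⟨xh, hxh, hxy⟩ := hhat (Y.deltaToHat ⟨y, hy⟩).2
  have hφx : φ ⟨xh, hxh⟩ = Y.deltaToHat ⟨y, hy⟩ := Subtype.ext hxy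
  have hcoset : IsOpen ((fun w : Y.DeltaHat => Y.deltaToHat ⟨y, hy⟩ * w) '' (V : Set Y.DeltaHat)) :=
    (Homeomorph.mulLeft (Y.deltaToHat ⟨y, hy⟩)).isOpenMap _ V.isOpen
  have hO : IsOpen (φ ⁻¹' ((fun w : Y.DeltaHat => Y.deltaToHat ⟨y, hy⟩ * w) ''
      (V : Set Y.DeltaHat))) := hcoset.preimage hφ
  have hne : (φ ⁻¹' ((fun w : Y.DeltaHat => Y.deltaToHat ⟨y, hy⟩ * w) ''
      (V : Set Y.DeltaHat))).Nonempty :=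
    ⟨⟨xh, hxh⟩, ⟨1, V.one_mem, by
      show Y.deltaToHat ⟨y, hy⟩ * 1 = φ ⟨xh, hxh⟩
      rw [mul_one, hφx]⟩⟩
  obtain ⟨d, hd⟩ := X.denseRange_deltaToHat.exists_mem_open hO hne
  obtain ⟨v, hv, hvd⟩ := hd
  have hφd : φ (X.deltaToHat d) = Y.deltaToHat (E.fDelta d) := by
    apply Subtype.ext
    change E.fHat (X.toHat (d : X.PiTemp)) = Y.toHat (E.f (d : X.PiTemp))
    exact (E.toHat_comp (d : X.PiTemp)).symm
  have hv' : v = Y.deltaToHat (⟨y, hy⟩⁻¹ * E.fDelta d) := by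
    rw [map_mul, map_inv, ← hφd, ← hvd, inv_mul_cancel_left]
  have hmem : (⟨y, hy⟩⁻¹ * E.fDelta d : Y.DeltaTemp) ∈ U.toSubgroup := by
    rw [hV, Subgroup.mem_comap]
    change Y.deltaToHat (⟨y, hy⟩⁻¹ * E.fDelta d) ∈ V.toSubgroup
    rw [← hv']
    exact hv
  have hmem' : y⁻¹ * E.f (d : X.PiTemp) ∈ L := Subgroup.mem_subgroupOf.mp hmem
  have hy' : y = E.f (d : X.PiTemp) * (y⁻¹ * E.f (d : X.PiTemp))⁻¹ := by
    rw [mul_inv_rev, inv_inv, mul_inv_cancel_left]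
  rw [hy']
  exact Subgroup.mul_mem_sup ⟨(d : X.PiTemp), d.2, rfl⟩ (Subgroup.inv_mem _ hmem')

/-- **`f(f⁻¹H′)` is profinitely dense in `H′`**: for every open normal subgroup `N` of FINITE
index of `Π^tp_Y` and every Y-index `H′`, `H′ ≤ f(f⁻¹H′) · (H′ ∩ N)` — (R1) for the open normal
finite-index `H′ ∩ N ≤ Δ^tp_Y` (under L3's parameter bundles, which give `Δ_Y = f̂(Δ_X)` and
`IsProfiniteCompletion Y.deltaToHat`), noting that `f(d) = h · m⁻¹ ∈ H′` forces `d ∈ f⁻¹H′`.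
[cite: MochizukiAbsTopI2012, Prop 4.10 (iii) p.60] -/
theorem le_mapComap_sup_inf (dX : X.GroupLevelData) (dY : Y.GroupLevelData)
    (H' : CharOpenSubgroup Y.DeltaTemp) (N : OpenNormalSubgroup Y.PiTemp)
    (hN : N.toSubgroup.FiniteIndex) :
    H'.toSubgroup ≤ (H'.toSubgroup.comap E.f.toMonoidHom).map E.f.toMonoidHom ⊔
      (H'.toSubgroup ⊓ N.toSubgroup) := by
  classical
  haveI : Y.DeltaTemp.Normal := by
    unfold TemperedCurve.DeltaTemp
    infer_instance
  haveI : H'.toSubgroup.Normal := H'.normal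
  haveI hLn : (H'.toSubgroup ⊓ N.toSubgroup).Normal := Subgroup.normal_inf_normal _ _
  let L : Subgroup Y.PiTemp := H'.toSubgroup ⊓ N.toSubgroup
  have hsub : L.subgroupOf Y.DeltaTemp =
      H'.toSubgroup.subgroupOf Y.DeltaTemp ⊓ N.toSubgroup.subgroupOf Y.DeltaTemp :=
    Subgroup.comap_inf _ _ Y.DeltaTemp.subtype
  have hLo : IsOpen ((L.subgroupOf Y.DeltaTemp : Subgroup Y.DeltaTemp) : Set Y.DeltaTemp) := by
    rw [hsub, Subgroup.coe_inf]
    exact H'.isOpen.inter (N.isOpen.preimage continuous_subtype_val)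
  haveI : (H'.toSubgroup.subgroupOf Y.DeltaTemp).FiniteIndex := H'.finiteIndex
  have hLf : (L.subgroupOf Y.DeltaTemp).FiniteIndex := by
    rw [hsub]
    infer_instance
  have hR1 := E.le_map_sup_of_deltaHat' (Y.isProfiniteCompletion_deltaToHat dY)
    (E.deltaHat_le_map_fHat (X.ker_augHat_eq_deltaHat dX).le) L hLo inferInstance hLf
  intro h hh
  have hh' : h ∈ ((X.DeltaTemp.map E.f.toMonoidHom ⊔ L : Subgroup Y.PiTemp) : Set Y.PiTemp) :=
    hR1 (H'.le hh)
  rw [Subgroup.mul_normal] at hh'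
  obtain ⟨a, ha, m, hm, ham⟩ := Set.mem_mul.mp hh'
  obtain ⟨g, -, rfl⟩ := ha
  have hfg : E.f.toMonoidHom g ∈ H'.toSubgroup := by
    have : E.f.toMonoidHom g = h * m⁻¹ := by rw [← ham, mul_inv_cancel_right]
    rw [this]
    exact H'.toSubgroup.mul_mem hh (H'.toSubgroup.inv_mem hm.1)
  rw [← ham]
  exact Subgroup.mul_mem_sup ⟨g, hfg, rfl⟩ hm

end DeCuspidalization

end AbsTopI.Prop410

end Literature.AnabelianGeometry.AbsoluteAnabelian

end
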